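import Summits.HubbardSuperconductivity.HubbardSuperconductivity.Theorems.LevyLogBootstrapHalfFilledOrderWindow
import Literature.MathematicalPhysics.QuantumLattice.XYZGroundStateOrderWindow

/-!
# Half-filled planar order on the certified window `Δ ∈ [-0.15, 0]`

Support file for the hub `HalfFilledOrder` (`stmt-HubbardSuperconductivity-0906`), sequel of
`LevyLogBootstrapHalfFilledOrderWindow.lean` (window `[-0.109, 0]` from Björnberg–Ueltschi's
printed spin-½ window). The Literature theorem `xxz_ground_lro_spinHalf_window'`
(`XYZGroundStateOrderWindow.lean`: the B–U/KLS assembly with the plaquette variational bound,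
PROVED for `0 ≤ -J₂ ≤ 0.15`) replaces `bjornbergUeltschi2022_ground_lro_spinHalf_holds`; the
rest of the argument (frame dictionary, sector identification, uniqueness) is reused verbatim
from the window file. Net effect: `halfFilledOrder_window` extends from `[-0.109, 0]` to
`[-0.15, 0]`, and the residue `halfFilledOrder_of_deepWindow` shrinks to `Δ ∈ (-1, -0.15)`.
-/

-- the mandated namespace `Summit.<Summit>.<Problem>.Theorems` repeats `HubbardSuperconductivity`
set_option linter.dupNamespace false

noncomputable section

namespace Summit.HubbardSuperconductivity.HubbardSuperconductivity.Theorems.LevyLogBootstrap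

open Matrix Finset Filter Complex
open Literature.MathematicalPhysics.QuantumLattice Literature.Probability.LatticeModels
open Summit.HubbardSuperconductivity.HubbardSuperconductivity.Theses.LevyLogBootstrap
open Summit.HubbardSuperconductivity.HubbardSuperconductivity.Theorems.AnisotropyChord
  (raiseOn_mul_lowerOn_mulVec_of_mem_zero)

/-- **The certified spin-½ planar window, floor form**: for `Δ ∈ [-0.15, 0]` there are `a > 0`
and `M₀` with `a·M⁴ ≤ Σ_{x,y} G³_M(x,y)` (third-axis ground-state correlation of
`anisotropicTorus 2 M 1 1 Δ 1`) for every even `M ≥ M₀` (`xxz_ground_lro_spinHalf_window'`, a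
positive `liminf` of a nonnegative sequence). [cite: KuboKishi1988]
[cite: BjornbergUeltschi2022, Theorem 3.2 and p. 11] -/
theorem plaquette_axisFloor {Δ : ℝ} (hΔ1 : -0.15 ≤ Δ) (hΔ0 : Δ ≤ 0) :
    ∃ a : ℝ, 0 < a ∧ ∃ M₀ : ℕ, ∀ (M : ℕ) [NeZero M], Even M → M₀ ≤ M →
      a * (M : ℝ) ^ 4 ≤
        ∑ x : TorusSite 2 M, ∑ y : TorusSite 2 M, groundStateAxisCorrTorus (d := 2) M 1 1 Δ 1 x y := by
  have hLRO := xxz_ground_lro_spinHalf_window' Δ (by linarith) (by linarith)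
  unfold HasEvenTorusLRO HasLongRangeOrder at hLRO
  rw [← Filter.liminf_nat_add _ 1] at hLRO
  have key : ∀ k : ℕ,
      (∑ x ∈ halfOpenBox 2 (2 * (k + 1)), ∑ y ∈ halfOpenBox 2 (2 * (k + 1)),
          torusPullback (fun L x y => groundStateAxisCorrTorus (d := 2) L 1 1 Δ 1 x y)
            (2 * (k + 1)) x y) /
        ((halfOpenBox 2 (2 * (k + 1))).card : ℝ) ^ 2 =
      (∑ x : TorusSite 2 (2 * k + 1 + 1), ∑ y : TorusSite 2 (2 * k + 1 + 1),
          groundStateAxisCorrTorus (d := 2) (2 * k + 1 + 1) 1 1 Δ 1 x y) /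
        (((2 * k + 1 + 1 : ℕ) : ℝ) ^ 2) ^ 2 := by
    intro k
    rw [show 2 * (k + 1) = 2 * k + 1 + 1 by ring, XYOrderProofs.sum_halfOpenBox_torusPullback,
      card_halfOpenBox, Nat.cast_pow]
  simp only [key] at hLRO
  have hnn : ∀ k : ℕ, 0 ≤ (∑ x : TorusSite 2 (2 * k + 1 + 1), ∑ y : TorusSite 2 (2 * k + 1 + 1),
      groundStateAxisCorrTorus (d := 2) (2 * k + 1 + 1) 1 1 Δ 1 x y) /
        (((2 * k + 1 + 1 : ℕ) : ℝ) ^ 2) ^ 2 :=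
    fun k => div_nonneg (sum_sum_groundStateAxisCorrTorus_nonneg _ 1 1 Δ 1) (by positivity)
  obtain ⟨a, ha0, hal⟩ := exists_between hLRO
  have hev := Filter.eventually_lt_of_lt_liminf hal (isBoundedUnder_of ⟨0, hnn⟩)
  obtain ⟨K₀, hK₀⟩ := Filter.eventually_atTop.1 hev
  refine ⟨a, ha0, 2 * K₀ + 2, fun M _ hMeven hM => ?_⟩
  obtain ⟨j, hj⟩ := hMeven
  obtain ⟨k, rfl⟩ : ∃ k, M = 2 * k + 1 + 1 := ⟨j - 1, by omega⟩
  have hk : K₀ ≤ k := by omega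
  have h := hK₀ k hk
  rw [lt_div_iff₀ (by positivity)] at h
  have h4 : (((2 * k + 1 + 1 : ℕ) : ℝ) ^ 2) ^ 2 = ((2 * k + 1 + 1 : ℕ) : ℝ) ^ 4 := by ring
  rw [h4] at h
  exact h.le

/-- **Half-filled planar order on the certified window** (hub `HalfFilledOrder`,
`stmt-HubbardSuperconductivity-0906`, restricted to `Δ ∈ [-0.15, 0]`): for every such `Δ` there
are `c > 0` and `M₀` such that every normalised `S³_tot = 0` sector ground state `ψ` of
`xxzHamiltonian 1 (torusGraph 2 M) (-1) Δ` on an even torus of side `M ≥ M₀` has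
`c·M⁴ ≤ Re⟨ψ, S⁺_tot S⁻_tot ψ⟩`. Same proof as `halfFilledOrder_window` with `plaquette_axisFloor`.
[cite: KuboKishi1988] [cite: BjornbergUeltschi2022, Theorem 3.2 and p. 11] -/
theorem halfFilledOrder_window015 : ∀ Δ ∈ Set.Icc (-0.15 : ℝ) 0, ∃ c : ℝ, 0 < c ∧ ∃ M₀ : ℕ, ∀ (M : ℕ) [NeZero M], Even M → M₀ ≤ M → ∀ (ψ : TensorIndex (TorusSite 2 M) 2 → ℂ), ψ ∈ @spinZSector (TorusSite 2 M) _ _ 1 0 → star ψ ⬝ᵥ ψ = 1 → Matrix.mulVec (xxzHamiltonian 1 (torusGraph 2 M) (-1) Δ) ψ = ((lowestEnergyInSector 1 (xxzHamiltonian 1 (torusGraph 2 M) (-1) Δ) 0 : ℝ) : ℂ) • ψ → c * (M : ℝ) ^ 4 ≤ (star ψ ⬝ᵥ Matrix.mulVec ((∑ x : TorusSite 2 M, onSite x (spinRaise 1)) * (∑ y : TorusSite 2 M, onSite y (spinLower 1))) ψ).re := by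
  intro Δ hΔ
  obtain ⟨a, ha, M₀, hfloor⟩ := plaquette_axisFloor hΔ.1 hΔ.2
  refine ⟨a, ha, max M₀ 4, fun M _ hM hMle ψ hψK hψ1 hHψ => ?_⟩
  have h4 : 4 ≤ M := le_of_max_le_right hMle
  have hM₀ : M₀ ≤ M := le_of_max_le_left hMle
  set H : Op (TorusSite 2 M) 2 := xxzHamiltonian 1 (torusGraph 2 M) (-1) Δ with hHdef
  obtain ⟨φ, hφ0, -, hspan, hEsec⟩ := xxzTorus_groundSpace_eq_span M hM h4 hΔ.2
  have hψG : ψ ∈ H.groundSpace := by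
    rw [mem_groundSpace_iff, ← hEsec]; exact hHψ
  have hψ0 : ψ ≠ 0 := fun h => by
    rw [h, dotProduct_zero] at hψ1
    exact zero_ne_one hψ1
  have hU : H.HasUniqueGroundState := by
    change Module.finrank ℂ H.groundSpace = 1
    rw [hspan]
    exact finrank_span_singleton hφ0
  have hω : ∀ O : Op (TorusSite 2 M) 2, H.groundStateFunctional O = star ψ ⬝ᵥ O *ᵥ ψ := fun O => by
    rw [groundStateFunctional_eq_of_hasUniqueGroundState hU hψG hψ0, hψ1, div_one]
  have hfl := hfloor M hM hM₀
  simp only [← re_groundStateFunctional_xx_eq_axisCorr] at hfl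
  rw [sum_sum_re_groundStateFunctional_siteSpin] at hfl
  have hY : 0 ≤ (H.groundStateFunctional (totalSpin 1 1 * totalSpin 1 1)).re :=
    re_groundStateFunctional_mul_self_nonneg _ (totalSpin_isHermitian 1 1)
  have hXY : a * (M : ℝ) ^ 4 ≤
      (H.groundStateFunctional (totalSpin 1 0 * totalSpin 1 0 + totalSpin 1 1 * totalSpin 1 1)).re := by
    rw [map_add, add_re]
    linarith
  rw [hω, ← raiseOn_mul_lowerOn_mulVec_of_mem_zero 1 hψK] at hXY
  exact hXY

/-- **What is left of `HalfFilledOrder` after the certified window**: the hub statement holds as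
soon as it holds on the deep easy-plane interval `Δ ∈ (-1, -0.15)`. [folklore] -/
theorem halfFilledOrder_of_deepWindow015
    (hdeep : ∀ Δ ∈ Set.Ioo (-1 : ℝ) (-0.15), ∃ c : ℝ, 0 < c ∧ ∃ M₀ : ℕ, ∀ (M : ℕ) [NeZero M],
      Even M → M₀ ≤ M → ∀ (ψ : TensorIndex (TorusSite 2 M) 2 → ℂ),
      ψ ∈ spinZSector (Λ := TorusSite 2 M) 1 0 → star ψ ⬝ᵥ ψ = 1 →
      Matrix.mulVec (xxzHamiltonian 1 (torusGraph 2 M) (-1) Δ) ψ =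
        ((lowestEnergyInSector 1 (xxzHamiltonian 1 (torusGraph 2 M) (-1) Δ) 0 : ℝ) : ℂ) • ψ →
      c * (M : ℝ) ^ 4 ≤ (star ψ ⬝ᵥ Matrix.mulVec
        ((∑ x : TorusSite 2 M, onSite x (spinRaise 1)) *
          (∑ y : TorusSite 2 M, onSite y (spinLower 1))) ψ).re) :
    HalfFilledOrder := by
  intro Δ hΔ
  by_cases hw : -0.15 ≤ Δ
  · exact halfFilledOrder_window015 Δ ⟨hw, hΔ.2⟩
  · exact hdeep Δ ⟨hΔ.1, lt_of_not_ge hw⟩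

end Summit.HubbardSuperconductivity.HubbardSuperconductivity.Theorems.LevyLogBootstrap

end
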